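import Summits.AtomisticToContinuum.HydrodynamicLimit.Theorems.RelayRaceLocalityLightConeInLawCone
import Literature.MathematicalPhysics.KineticTheory.HardSphereEulerDim
import Literature.MathematicalPhysics.KineticTheory.HardSphereCanonicalTorus
import HarnessLib

/-!
# RelayRaceLocality · ConeLocalisation — bubble stub, helper (D): support preservation of bubbles

Helper file for the lead-held stub `stub_bubble : BubbleAtScale` of the line `Sketch` (zoomed-bubble-transplant)
of the crux item `stmt-AtomisticToContinuum-12504` (`ConeLocalisation`, route RelayRaceLocality of
`AtomisticToContinuum/HydrodynamicLimit`), lead prover-line-stmt-AtomisticToContinuum-12504-0 (2026-08-17).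

A classical hard-sphere Euler solution whose time-`0` data equal a constant state `(ρ̄, ū, θ̄)` outside the ball
`B(x₀, a)` still equals that constant state at time `t` outside `B(x₀, a + c t)`, with the reduced-cone speed
`c = c(M)` of the tree's finite domain of dependence (`LightConeInLawSketch.DoD.reducedConeUniqueness`, Dafermos
2005 Thm 5.2.1 in reduced units), as long as the packing stays below its threshold `ηD` and temperature / speed stay
`≤ M` on `[0, t]`. Proof: compare the solution with the CONSTANT solution (`IsHardSphereEulerSolutionDim.const`) by
`reducedConeUniqueness` at equal diameters, centred at the target point `x` with radius `dist(x, x₀) - a`, inside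
which the data are constant by the triangle inequality. This is what keeps the zoomed bubble compactly supported
(hence transplantable to the unit torus) in the proof of `BubbleAtScale`.
-/

noncomputable section

namespace Summit.AtomisticToContinuum.HydrodynamicLimit.Theorems.ConeLocalisation.Bubble

open Set
open Literature.MathematicalPhysics.KineticTheory Literature.Analysis.FluidPDE
  Literature.Analysis.FunctionSpaces
open Summit.AtomisticToContinuum.HydrodynamicLimit.Theorems

/-- **Support preservation (finite speed of propagation against a constant state).** There is a packing threshold
`ηD > 0` and, for every bound `M > 0`, a speed `c = c(M) > 0` such that: if a classical hard-sphere Euler solution at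
reduced diameter `σ > 0` has packing `< ηD`, temperature `≤ M` and speed `≤ M` on `[0, t]` (`0 ≤ t < T`), and its
time-`0` data equal the constant state `(ρ̄, ū, θ̄)` (`ρ̄, θ̄ > 0`, `ρ̄σ³ < ηD`, `θ̄ ≤ M`, `‖ū‖ ≤ M`) at every point of
distance `≥ a` from `x₀`, then at time `t` the solution equals that constant state at every point of distance
`> a + c t` from `x₀`. [cite: Dafermos2005, Thm 5.2.1] -/
theorem support_preservation :
    ∃ ηD : ℝ, 0 < ηD ∧ ∀ M : ℝ, 0 < M → ∃ c : ℝ, 0 < c ∧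
      ∀ σ : ℝ, 0 < σ → ∀ (T : ℝ) (ρ θ : ℝ → T3 → ℝ) (u : ℝ → T3 → V3),
        IsHardSphereEulerSolution σ T ρ u θ →
      ∀ (ρbar θbar : ℝ) (ubar : V3), 0 < ρbar → 0 < θbar → ρbar * σ ^ 3 < ηD → θbar ≤ M → ‖ubar‖ ≤ M →
      ∀ t : ℝ, 0 ≤ t → t < T →
        (∀ s ∈ Set.Icc 0 t, ∀ x, ρ s x * σ ^ 3 < ηD ∧ θ s x ≤ M ∧ ‖u s x‖ ≤ M) →
      ∀ (x₀ : T3) (a : ℝ),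
        (∀ x, a ≤ Torus.euclidDist x x₀ → ρ 0 x = ρbar ∧ u 0 x = ubar ∧ θ 0 x = θbar) →
      ∀ x, a + c * t < Torus.euclidDist x x₀ → ρ t x = ρbar ∧ u t x = ubar ∧ θ t x = θbar := by
  obtain ⟨η₂, hη₂, H⟩ := LightConeInLawSketch.DoD.reducedConeUniqueness
  refine ⟨η₂, hη₂, fun M hM => ?_⟩
  obtain ⟨c, hc, Hc⟩ := H M hM
  refine ⟨c, hc, fun σ hσ T ρ θ u hE ρbar θbar ubar hρbar hθbar hpack hθM huM t ht0 htT hg x₀ a hdata x hx => ?_⟩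
  have hσ3 : (0 : ℝ) < σ ^ 3 := pow_pos hσ 3
  -- the constant comparison solution on the same horizon and at the same diameter
  have hC : IsHardSphereEulerSolution σ T (fun _ _ => ρbar) (fun _ _ => ubar) (fun _ _ => θbar) :=
    isHardSphereEulerSolutionDim_three_iff.1 (IsHardSphereEulerSolutionDim.const σ T ubar hρbar hθbar)
  -- guards for the pair (solution, constant)
  have hguards : ∀ s ∈ Set.Icc 0 t, ∀ y, ρ s y * σ ^ 3 < η₂ ∧ θ s y ≤ M ∧ ‖u s y‖ ≤ M ∧
      (fun (_ : ℝ) (_ : T3) => ρbar) s y * σ ^ 3 < η₂ ∧ (fun (_ : ℝ) (_ : T3) => θbar) s y ≤ M ∧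
      ‖(fun (_ : ℝ) (_ : T3) => ubar) s y‖ ≤ M := by
    intro s hs y
    obtain ⟨g1, g2, g3⟩ := hg s hs y
    exact ⟨g1, g2, g3, hpack, hθM, huM⟩
  -- agreement of the reduced data on the ball of radius `dist(x, x₀) - a` round the target point `x`
  set R : ℝ := Torus.euclidDist x x₀ - a with hR
  have hagree : ∀ y, Torus.euclidDist y x < R →
      ρ 0 y * σ ^ 3 = (fun (_ : ℝ) (_ : T3) => ρbar) 0 y * σ ^ 3 ∧ u 0 y = (fun (_ : ℝ) (_ : T3) => ubar) 0 y ∧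
        θ 0 y = (fun (_ : ℝ) (_ : T3) => θbar) 0 y := by
    intro y hy
    have htri : Torus.euclidDist x x₀ ≤ Torus.euclidDist x y + Torus.euclidDist y x₀ := euclidDist_triangle x y x₀
    have hyx : Torus.euclidDist x y = Torus.euclidDist y x := Torus.euclidDist_comm x y
    have hfar : a ≤ Torus.euclidDist y x₀ := by
      rw [hR] at hy
      linarith
    obtain ⟨h1, h2, h3⟩ := hdata y hfar
    exact ⟨by rw [h1], h2, h3⟩
  have hxin : Torus.euclidDist x x < R - c * t := by
    rw [Torus.euclidDist_self, hR]
    linarith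
  obtain ⟨h1, h2, h3⟩ := Hc σ σ hσ hσ T T ρ θ (fun _ _ => ρbar) (fun _ _ => θbar) u (fun _ _ => ubar) hE hC t ht0
    htT htT hguards x R hagree x hxin
  refine ⟨?_, h2, h3⟩
  have h1' : ρ t x * σ ^ 3 = ρbar * σ ^ 3 := h1
  exact mul_right_cancel₀ hσ3.ne' h1'

end Summit.AtomisticToContinuum.HydrodynamicLimit.Theorems.ConeLocalisation.Bubble

end
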